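import Literature.IUT.LogVolume.Xi3Model
import HarnessLib

/-!
# [IUTchIII] Remark 3.9.5 (iv) (Ξ3), the example: `H_Ξ(P) ≠ φ(P)` for the hull-sets `λ·O` as defined

Mochizuki, [IUTchIII] Rmk. 3.9.5 (iv), the example after (Ξ3), kurims p. 129 (own render): `I = ℚ_p × ℚ_p`,
`H₀ = ℤ_p × ℤ_p`, `H₁ = (p^{-1}ℤ_p) × (pℤ_p)`, `P = H₀ ∪ ({p^{-1}} × ℤ_p)`, `H_P = (p^{-1}ℤ_p) × ℤ_p`; "`H_P`
corresponds to `φ(P)`; `H₀` and `H₁` correspond to elements of `Ξ(P)` … `μ_I(P) = μ_I(H₀) = 1 < 2 − p^{-1} =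
μ_I(H₀ ∪ H₁)`" (PROVED in the model by abc-iut-S2, `Xi3Model.lean`: `lt_Xi3_example`,
`vol_P_lt_vol_H0_union_H1`), followed by: "In fact, by considering various translates of `H₀`, `H₁` by
automorphisms of the `ℤ_p`-module `H_P`, one verifies immediately that `H_P` corresponds not only to
`φ(P) = H_Φ(P)`, but also to `H_Ξ(P)`. That is to say, this is a situation in which one has
`H_Ξ(P) = H_Φ(P) = φ(P)`".

With `Hul` = the hull-sets AS DEFINED in Rmk. 3.9.5 (i)(ii) (p. 127: "`λ·𝒪_{(−)}`, … each component of `λ`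
… is nonzero" — the layer-L6 typing `LogThetaLattice.HXi Hul φ μlog P := ⋃ Ξ(P)`, abc-iut-L6-t4, and S2's
model `hullSets`), the last sentence FAILS in the model: `Ξ(P) = {H₀, H₁}` (a hull-set `ϖ^m O × ϖ^n O ⊆ H_P`
of volume `1` has `(m, n) ∈ {(0,0), (−1,1)}`), and the point `(ϖ^{-1}, 1) ∈ H_P` lies in neither — a
translate of `H₁` by a non-diagonal `ℤ_p`-automorphism of `H_P` is not of the form `λ·O`.  This file proves
`lt_hXi_ne_holomorphicHull` (for ANY nonarchimedean local field `K` in the norm presentation, `μ^log :=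
log` of S2's normalised product volume).  READING NOTE recorded at kernel level (the strict inequality
(Ξ3), which is the point of the example, is unaffected); outside the [IUTchIII] Cor. 3.12 cone; no side
taken on Cor. 3.12.  Also recorded: the example's own `P = (ℤ_p ∪ {p^{-1}}) × ℤ_p` is a direct product
region with a NON-open compact factor (cf. `Xi1ModelNegative.lean`).
[cite: Mochizuki2012, IUTchIII Rmk. 3.9.5 (iv) p. 129] [cite: Mochizuki2012, IUTchIII Rmk. 3.9.5 (i)(ii) p. 127]
-/

noncomputable section

open MeasureTheory Set Metric TopologicalSpace Bornology
open scoped ENNReal NNReal Pointwise NormedField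
open Literature.NumberTheory.GaloisRepresentations.Ultrametric

namespace Literature.IUT.LogVolume

namespace Xi3

variable {K : Type*} [NontriviallyNormedField K] [IsUltrametricDist K] [ProperSpace K]
  [MeasurableSpace K] [BorelSpace K]

omit [IsUltrametricDist K] [ProperSpace K] [MeasurableSpace K] [BorelSpace K] in
/-- `P = H₀ ∪ ({ϖ⁻¹} × O)` lies in the box `ϖ⁻¹O × O` (`= H_P`).
[cite: Mochizuki2012, IUTchIII Rmk. 3.9.5 (iv) p. 129] -/
theorem P_subset_box (ϖ : Kˣ) (hϖ : IsUniformizer ϖ) :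
    P K ϖ ⊆ polydisc (Pair K) ![‖(ϖ : K)‖⁻¹, 1] := by
  have h1 : (1 : ℝ) ≤ ‖(ϖ : K)‖⁻¹ := one_le_inv_iff₀.mpr ⟨norm_units_pos ϖ, hϖ.norm_lt_one.le⟩
  rintro u (hu | hu)
  · rw [H0, mem_polydisc] at hu
    rw [mem_polydisc]
    intro j
    fin_cases j
    · exact (hu 0).trans (by simpa using h1)
    · simpa using hu 1
  · rw [slice, Set.mem_univ_pi] at hu
    rw [mem_polydisc]
    intro j
    fin_cases j
    · have := hu 0
      simp only [Matrix.cons_val_zero, mem_singleton_iff] at this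
      simp [this]
    · have := hu 1
      simp only [Matrix.cons_val_one, Matrix.cons_val_zero, mem_closedBall_zero_iff] at this
      simpa using this

omit [IsUltrametricDist K] [ProperSpace K] [MeasurableSpace K] [BorelSpace K] in
/-- **`φ(P) = H_P = ϖ⁻¹O × O`** in the model (the constructed holomorphic hull of `P`).
[cite: Mochizuki2012, IUTchIII Rmk. 3.9.5 (iv) p. 129] -/
theorem holomorphicHull_P (ϖ : Kˣ) (hϖ : IsUniformizer ϖ) :
    holomorphicHull (Pair K) (P K ϖ) = polydisc (Pair K) ![‖(ϖ : K)‖⁻¹, 1] := by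
  have hsub := P_subset_box ϖ hϖ
  have hbdd : IsBounded (P K ϖ) := (isBounded_polydisc (Pair K) _).subset hsub
  rw [holomorphicHull_of_isBounded (Pair K) hbdd]
  -- witnesses attaining the radii: `(ϖ⁻¹, 0) ∈ {ϖ⁻¹} × O` and `(0, 1) ∈ H₀`
  have hw0 : (fun j => (![((ϖ : K)⁻¹ : K), 0] : Fin 2 → K) j) ∈ P K ϖ := by
    refine Or.inr ?_
    rw [slice, Set.mem_univ_pi]
    intro j
    fin_cases j <;> simp
  have hw1 : (fun j => (![(0 : K), 1] : Fin 2 → K) j) ∈ P K ϖ := by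
    refine Or.inl ?_
    rw [H0, mem_polydisc]
    intro j
    fin_cases j <;> simp
  congr 1
  funext j
  refine le_antisymm (hullRadius_le_of_subset_polydisc (Pair K) (fun i => ?_) hsub j) ?_
  · fin_cases i
    · simp
    · simp
  · fin_cases j
    · simpa using norm_apply_le_hullRadius (Pair K) hbdd hw0 0
    · simpa using norm_apply_le_hullRadius (Pair K) hbdd hw1 1

/-- `μ(H_P) = μ(ϖ⁻¹O × O) = q`. [cite: Mochizuki2012, IUTchIII Rmk. 3.9.5 (iv) p. 129] -/
theorem vol_box {ϖ : Kˣ} (hϖ : IsUniformizer ϖ) :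
    vol K (polydisc (Pair K) ![‖(ϖ : K)‖⁻¹, 1]) = residueCard K := by
  rw [vol, piVolume_polydisc, ENNReal.toReal_prod, Fin.prod_univ_two]
  simp only [Matrix.cons_val_zero, Matrix.cons_val_one]
  change (localVolume K (closedBall (0 : K) ‖(ϖ : K)‖⁻¹)).toReal *
    (localVolume K (closedBall (0 : K) 1)).toReal = _
  rw [localVolume_real_ball_inv_norm hϖ, localVolume_closedBall_one, ENNReal.toReal_one, mul_one]

/-- **The printed "`H_Ξ(P) = φ(P)`" fails for the hull-sets `λ·O`**: with `Hul :=` S2's `hullSets`,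
`φ :=` the constructed `holomorphicHull` and `μ^log := log μ_I` (S2's normalised product volume), the
union `H_Ξ(P)` of the log-volume hull-approximants of the example's `P` is NOT `φ(P) = H_P`: the point
`(ϖ⁻¹, 1) ∈ H_P` lies in no hull-set `H ⊆ H_P` of volume `μ(P) = 1` (such an `H ∋ (ϖ⁻¹, 1)` must be
`H_P` itself, of volume `q ≠ 1`).  [cite: Mochizuki2012, IUTchIII Rmk. 3.9.5 (iv) p. 129] -/
theorem lt_hXi_ne_holomorphicHull {ϖ : Kˣ} (hϖ : IsUniformizer ϖ) :
    LogThetaLattice.HXi (hullSets (Pair K)) (holomorphicHull (Pair K))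
        (fun S => Real.log (vol K S)) (P K ϖ) ≠ holomorphicHull (Pair K) (P K ϖ) := by
  intro heq
  rw [holomorphicHull_P ϖ hϖ] at heq
  -- the point `x = (ϖ⁻¹, 1) ∈ H_P`
  set x : Π j : Fin 2, Pair K j := fun j => (![((ϖ : K)⁻¹ : K), 1] : Fin 2 → K) j with hxdef
  have hx : x ∈ polydisc (Pair K) ![‖(ϖ : K)‖⁻¹, 1] := by
    rw [mem_polydisc]
    intro j
    fin_cases j <;> simp [hxdef]
  rw [← heq, LogThetaLattice.HXi, Set.mem_sUnion] at hx
  obtain ⟨H, ⟨hHul, hHsub, hHvol⟩, hxH⟩ := hx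
  rw [holomorphicHull_P ϖ hϖ] at hHsub
  -- `H = c·O` with `‖c₀‖ = ‖ϖ‖⁻¹`, `‖c₁‖ = 1`, i.e. `H = H_P`
  obtain ⟨c, hc, rfl⟩ := hHul
  have hupper : ∀ j, ‖c j‖ ≤ (![‖(ϖ : K)‖⁻¹, 1] : Fin 2 → ℝ) j := fun j => by
    have : c ∈ hullSet (Pair K) c := (mem_polydisc (Pair K)).mpr fun i => le_rfl
    exact (mem_polydisc (Pair K)).mp (hHsub this) j
  have hlower : ∀ j, (![‖(ϖ : K)‖⁻¹, 1] : Fin 2 → ℝ) j ≤ ‖c j‖ := fun j => by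
    have := (mem_polydisc (Pair K)).mp hxH j
    fin_cases j
    · simpa [hxdef] using this
    · simpa [hxdef] using this
  have hH : hullSet (Pair K) c = polydisc (Pair K) ![‖(ϖ : K)‖⁻¹, 1] := by
    unfold hullSet
    congr 1
    funext j
    exact le_antisymm (hupper j) (hlower j)
  -- volumes: `log q = log μ(P) = log 1`
  rw [hH] at hHvol
  change Real.log (vol K (polydisc (Pair K) ![‖(ϖ : K)‖⁻¹, 1])) = Real.log (vol K (P K ϖ)) at hHvol
  rw [vol_box hϖ, vol_P ϖ, Real.log_one] at hHvol
  have hq : (1 : ℝ) < residueCard K := one_lt_residueCard_real K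
  have := Real.log_pos hq
  linarith

end Xi3

end Literature.IUT.LogVolume

end
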